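import Summits.QuantumAdvantage.QuantumAdvantage.Theorems.ArithStatLadderIqThreeNotPPolyStubApSieve

/-!
# Crux `ArithStatLadder.IqThreeNotPPoly` (stmt-QuantumAdvantage-2422)

Stub `stub_shiftPairsCount` of the line `Sketch` (rung R3): COUNTING SHIFTED SQUAREFREE PAIRS.

For `n ≥ 40` and every bit position `j` with `n + 16 ≤ 2j` and `j + 2 ≤ n`, at least `2ⁿ / 512`
numerals `N ∈ [2^{n-1}, 2ⁿ)` satisfy: `N ≡ 3 (mod 4)`, bit `j` of `N` is `0`, `N` is squarefree,
and `9 ∣ N + 2ʲ` (so the bit-`j` flip `N + 2ʲ` of `N` is not squarefree).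

Proof (elementary, explicit constants, Mathlib + the landed sieve `stub_apSieve`). Pick `a₀ < 36`
with `a₀ ≡ 3 (mod 4)` and `a₀ ≡ -2ʲ (mod 9)`; it is coprime to `36` because `3 ∤ 2ʲ`. The numerals
in `[2^{n-1}, 2ⁿ)` whose bit `j` is zero form `M = 2^{n-2-j}` dyadic blocks `[b_m, b_m + 2ʲ)`,
`b_m = 2^{n-1} + m·2^{j+1}`. In block `m` consider the arithmetic progression `x_m + 36k`,
`k < K = ⌊2ʲ/36⌋`, where `x_m ∈ [b_m, b_m + 36)` is `≡ a₀ (mod 36)`: its members satisfy all the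
congruence and bit conditions, and by `stub_apSieve` (modulus `36`; every prime not dividing `36`
is `≥ 5`) at most `K/4 + √(2ⁿ)` of them are not squarefree. As `128·√(2ⁿ) ≤ 2ʲ` (this is where
`j ≥ n/2 + 8` enters), every block contributes `≥ (3K - 4√(2ⁿ))/4 ≥ 2ʲ/128` good numerals, and
`(m, k) ↦ x_m + 36k` is injective (the block index is read off from `N / 2^{j+1} = M + m`), whence
`#good ≥ M·2ʲ/128 = 2ⁿ/512`.
-/

set_option linter.dupNamespace false -- D-0017: single-problem summit ⇒ `QuantumAdvantage.QuantumAdvantage` by design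

namespace Summit.QuantumAdvantage.QuantumAdvantage.Theorems.IqThreeNotPPoly

open scoped Classical
open Finset

/-- A prime not dividing `36` is at least `5` (the primes below `5` are `2` and `3`). -/
theorem shiftPairs_prime_ge_five : ∀ p : ℕ, p.Prime → ¬ p ∣ 36 → 5 ≤ p := by
  intro p hp hdvd
  by_contra h
  have h2 := hp.two_le
  interval_cases p
  · exact hdvd (by norm_num)
  · exact hdvd (by norm_num)
  · exact absurd hp (by norm_num)

/-- The residue class: for every `j` there is `a₀ < 36`, coprime to `36`, with `a₀ ≡ 3 (mod 4)`
and `9 ∣ a₀ + 2ʲ` (possible because `3 ∤ 2ʲ`). -/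
theorem shiftPairs_residue (j : ℕ) :
    ∃ a₀ : ℕ, a₀ < 36 ∧ a₀ % 4 = 3 ∧ (a₀ + 2 ^ j) % 9 = 0 ∧ Nat.Coprime a₀ 36 := by
  have h3 : ¬ 3 ∣ 2 ^ j := by
    intro h
    have := Nat.Prime.dvd_of_dvd_pow Nat.prime_three h
    omega
  obtain ⟨P, hP⟩ : ∃ P : ℕ, P = 2 ^ j := ⟨_, rfl⟩
  rw [← hP] at h3 ⊢
  obtain ⟨a₀, ha₀⟩ : ∃ a₀ : ℕ, a₀ = (9 - P % 9) % 9 + 9 * ((39 - (9 - P % 9) % 9) % 4) :=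
    ⟨_, rfl⟩
  have hn2 : ¬ 2 ∣ a₀ := by omega
  have hn3 : ¬ 3 ∣ a₀ := by omega
  refine ⟨a₀, by omega, by omega, by omega, ?_⟩
  have hc2 : Nat.Coprime a₀ 2 := ((Nat.Prime.coprime_iff_not_dvd Nat.prime_two).2 hn2).symm
  have hc3 : Nat.Coprime a₀ 3 := ((Nat.Prime.coprime_iff_not_dvd Nat.prime_three).2 hn3).symm
  have h36 : (36 : ℕ) = 2 ^ 2 * 3 ^ 2 := by norm_num
  rw [h36]
  exact Nat.Coprime.mul_right (hc2.pow_right 2) (hc3.pow_right 2)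

/-- The start of the progression: the least `x ≥ b` with `x ≡ a₀ (mod 36)` lies in `[b, b + 36)`
and is coprime to `36` when `a₀` is. -/
theorem shiftPairs_ap_start (a₀ b : ℕ) (ha : a₀ < 36) (hcop : Nat.Coprime a₀ 36) :
    ∃ x : ℕ, b ≤ x ∧ x < b + 36 ∧ x % 36 = a₀ ∧ Nat.Coprime x 36 := by
  refine ⟨b + (a₀ + 36 - b % 36) % 36, by omega, by omega, by omega, ?_⟩
  have e : b + (a₀ + 36 - b % 36) % 36 = a₀ + 36 * ((b + (a₀ + 36 - b % 36) % 36) / 36) := by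
    omega
  rw [e, Nat.coprime_add_mul_left_left]
  exact hcop

/-- Block geometry. With `A = 2^{j+1}`, `M = 2^{n-2-j}` and `j + 2 ≤ n` one has `M·A = 2^{n-1}`;
hence a point `2^{n-1} + m·A + t` with `m < M`, `t < A` is `< 2ⁿ`, and its quotient by `A` is
`M + m` (the block index is recovered by division). -/
theorem shiftPairs_block (n j m t : ℕ) (hjn : j + 2 ≤ n) (hm : m < 2 ^ (n - 2 - j))
    (ht : t < 2 ^ (j + 1)) :
    2 ^ (n - 1) + m * 2 ^ (j + 1) + t < 2 ^ n ∧
      (2 ^ (n - 1) + m * 2 ^ (j + 1) + t) / 2 ^ (j + 1) = 2 ^ (n - 2 - j) + m := by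
  have hMA : 2 ^ (n - 2 - j) * 2 ^ (j + 1) = 2 ^ (n - 1) := by
    rw [← pow_add, (by omega : n - 2 - j + (j + 1) = n - 1)]
  have h2n : (2 : ℕ) ^ n = 2 ^ (n - 1) * 2 := by
    rw [← pow_succ, (by omega : n - 1 + 1 = n)]
  constructor
  · have h1 : (m + 1) * 2 ^ (j + 1) ≤ 2 ^ (n - 2 - j) * 2 ^ (j + 1) :=
      Nat.mul_le_mul_right _ (by omega)
    rw [hMA, Nat.succ_mul] at h1
    omega
  · have e : 2 ^ (n - 1) + m * 2 ^ (j + 1) + t = t + 2 ^ (j + 1) * (2 ^ (n - 2 - j) + m) := by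
      rw [Nat.mul_add, mul_comm (2 ^ (j + 1)) (2 ^ (n - 2 - j)), hMA]; ring
    rw [e, Nat.add_mul_div_left _ _ (Nat.two_pow_pos _), Nat.div_eq_of_lt ht, zero_add]

/-- Bit `j` of a point `2^{n-1} + m·2^{j+1} + t` with `t < 2ʲ` is `0`
(write it as `2^{j+1}·(2^{n-2-j} + m) + t` and read off bit `j < j + 1` from `t`). -/
theorem shiftPairs_testBit (n j m t : ℕ) (hjn : j + 2 ≤ n) (ht : t < 2 ^ j) :
    (2 ^ (n - 1) + m * 2 ^ (j + 1) + t).testBit j = false := by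
  have hMA : 2 ^ (j + 1) * 2 ^ (n - 2 - j) = 2 ^ (n - 1) := by
    rw [← pow_add, (by omega : j + 1 + (n - 2 - j) = n - 1)]
  have e : 2 ^ (n - 1) + m * 2 ^ (j + 1) + t = 2 ^ (j + 1) * (2 ^ (n - 2 - j) + m) + t := by
    rw [Nat.mul_add, hMA]; ring
  have ht' : t < 2 ^ (j + 1) :=
    lt_of_lt_of_le ht (Nat.pow_le_pow_right (by norm_num) (by omega))
  rw [e, Nat.testBit_two_pow_mul_add _ ht', if_pos (by omega)]
  exact Nat.testBit_lt_two_pow ht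

/-- The block index of a progression element: if `b_m ≤ x < b_m + 36` and `36(k+1) ≤ 2ʲ` then
`(x + 36k) / 2^{j+1} = 2^{n-2-j} + m`. -/
theorem shiftPairs_ap_div (n j m x k : ℕ) (hjn : j + 2 ≤ n) (hm : m < 2 ^ (n - 2 - j))
    (hx1 : 2 ^ (n - 1) + m * 2 ^ (j + 1) ≤ x) (hx2 : x < 2 ^ (n - 1) + m * 2 ^ (j + 1) + 36)
    (hk : 36 * (k + 1) ≤ 2 ^ j) :
    (x + 36 * k) / 2 ^ (j + 1) = 2 ^ (n - 2 - j) + m := by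
  obtain ⟨t, ht⟩ : ∃ t, x + 36 * k = 2 ^ (n - 1) + m * 2 ^ (j + 1) + t :=
    ⟨x + 36 * k - (2 ^ (n - 1) + m * 2 ^ (j + 1)), by omega⟩
  have htA : t < 2 ^ (j + 1) := by rw [pow_succ]; omega
  rw [ht]
  exact (shiftPairs_block n j m t hjn hm htA).2

/-- Each progression element `N = x + 36k` (`x ≡ a₀ (mod 36)` in `[b_m, b_m + 36)`, `36(k+1) ≤ 2ʲ`,
`N` squarefree) is one of the numerals counted by the stub. -/
theorem shiftPairs_ap_mem (n j a₀ m x k : ℕ) (hjn : j + 2 ≤ n) (hm : m < 2 ^ (n - 2 - j))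
    (ha4 : a₀ % 4 = 3) (ha9 : (a₀ + 2 ^ j) % 9 = 0)
    (hx1 : 2 ^ (n - 1) + m * 2 ^ (j + 1) ≤ x) (hx2 : x < 2 ^ (n - 1) + m * 2 ^ (j + 1) + 36)
    (hx3 : x % 36 = a₀) (hk : 36 * (k + 1) ≤ 2 ^ j) (hsq : Squarefree (x + 36 * k)) :
    x + 36 * k ∈ (Finset.range (2 ^ n)).filter (fun N : ℕ =>
      2 ^ (n - 1) ≤ N ∧ N % 4 = 3 ∧ N.testBit j = false ∧ Squarefree N ∧ 9 ∣ N + 2 ^ j) := by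
  obtain ⟨t, ht⟩ : ∃ t, x + 36 * k = 2 ^ (n - 1) + m * 2 ^ (j + 1) + t :=
    ⟨x + 36 * k - (2 ^ (n - 1) + m * 2 ^ (j + 1)), by omega⟩
  have htj : t < 2 ^ j := by omega
  have htA : t < 2 ^ (j + 1) := by rw [pow_succ]; omega
  have hlt : x + 36 * k < 2 ^ n := by rw [ht]; exact (shiftPairs_block n j m t hjn hm htA).1
  have hbit : (x + 36 * k).testBit j = false := by rw [ht]; exact shiftPairs_testBit n j m t hjn htj
  rw [Finset.mem_filter, Finset.mem_range]
  exact ⟨hlt, by omega, by omega, hbit, hsq, by omega⟩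

/-- The sieve in one block: a progression `x + 36k`, `k < K`, with `gcd(x, 36) = 1` and
`x + 36K ≤ B` has at least `(3K - 4√B)/4` squarefree members (`stub_apSieve` with `p₀ = 5`). -/
theorem shiftPairs_block_count (x K B : ℕ) (hcop : Nat.Coprime x 36) (hB : x + 36 * K ≤ B) :
    3 * K ≤ 4 * ((Finset.range K).filter (fun k => Squarefree (x + 36 * k))).card +
      4 * Nat.sqrt B := by
  have hs := stub_apSieve x 36 K 5 (by norm_num) hcop (by norm_num) shiftPairs_prime_ge_five
  have hsq := Nat.sqrt_le_sqrt hB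
  have hsum := Finset.card_filter_add_card_filter_not (s := Finset.range K)
    (fun k => Squarefree (x + 36 * k))
  rw [Finset.card_range] at hsum
  omega

/-- **STUB R3 · `stub_shiftPairsCount`**: for `n ≥ 40` and every position `j` with `n + 16 ≤ 2j`,
`j + 2 ≤ n`, at least `2ⁿ/512` numerals `N ∈ [2^{n-1}, 2ⁿ)` have `N ≡ 3 (mod 4)`, bit `j` zero,
`N` squarefree and `9 ∣ N + 2ʲ`. -/
theorem stub_shiftPairsCount :
    ∃ n₀ : ℕ, ∀ n : ℕ, n₀ ≤ n → ∀ j : ℕ, n + 16 ≤ 2 * j → j + 2 ≤ n →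
      2 ^ n ≤ 512 * ((Finset.range (2 ^ n)).filter (fun N : ℕ =>
        2 ^ (n - 1) ≤ N ∧ N % 4 = 3 ∧ N.testBit j = false ∧ Squarefree N ∧ 9 ∣ N + 2 ^ j)).card := by
  refine ⟨40, ?_⟩
  intro n hn j hj1 hj2
  obtain ⟨a₀, ha36, ha4, ha9, hcop⟩ := shiftPairs_residue j
  -- the atoms `M = 2^{n-2-j}` (number of blocks), `K = ⌊2ʲ/36⌋` (progression length),
  -- `S = √(2ⁿ)` (sieve error) and the linear facts relating them to `2ʲ`, `2ⁿ`
  obtain ⟨M, hM⟩ : ∃ M : ℕ, M = 2 ^ (n - 2 - j) := ⟨_, rfl⟩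
  obtain ⟨K, hK⟩ : ∃ K : ℕ, K = 2 ^ j / 36 := ⟨_, rfl⟩
  obtain ⟨S, hS⟩ : ∃ S : ℕ, S = Nat.sqrt (2 ^ n) := ⟨_, rfl⟩
  have hP : 512 ≤ 2 ^ j :=
    calc (512 : ℕ) = 2 ^ 9 := by norm_num
      _ ≤ 2 ^ j := Nat.pow_le_pow_right (by norm_num) (by omega)
  have hA : (2 : ℕ) ^ (j + 1) = 2 ^ j * 2 := pow_succ 2 j
  have hK1 : 36 * K ≤ 2 ^ j := by omega
  have hK2 : 2 ^ j < 36 * K + 36 := by omega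
  have h128 : 128 * S ≤ 2 ^ j := by
    have h1 : S < 2 ^ (n / 2 + 1) := by
      rw [hS, Nat.sqrt_lt', ← pow_mul]
      exact Nat.pow_lt_pow_right (by norm_num) (by omega)
    have h2 : 128 * 2 ^ (n / 2 + 1) ≤ 2 ^ j := by
      rw [show (128 : ℕ) = 2 ^ 7 by norm_num, ← pow_add]
      exact Nat.pow_le_pow_right (by norm_num) (by omega)
    omega
  have h96 : 2 ^ j + 128 * S ≤ 96 * K := by omega
  have h2n : 2 ^ n = 4 * (M * 2 ^ j) := by
    have e : n - 2 - j + j + 2 = n := by omega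
    rw [hM]
    calc (2 : ℕ) ^ n = 2 ^ (n - 2 - j + j + 2) := by rw [e]
      _ = 4 * (2 ^ (n - 2 - j) * 2 ^ j) := by rw [pow_add, pow_add]; ring
  -- the progressions: `x m ≡ a₀ (mod 36)` in `[b_m, b_m + 36)`, `b_m = 2^{n-1} + m·2^{j+1}`
  have hex : ∀ m : ℕ, ∃ x : ℕ, 2 ^ (n - 1) + m * 2 ^ (j + 1) ≤ x ∧
      x < 2 ^ (n - 1) + m * 2 ^ (j + 1) + 36 ∧ x % 36 = a₀ ∧ Nat.Coprime x 36 :=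
    fun m => shiftPairs_ap_start a₀ _ ha36 hcop
  choose x hx using hex
  -- per-block count
  have hblock : ∀ m ∈ Finset.range M,
      3 * K ≤ 4 * ((Finset.range K).filter (fun k => Squarefree (x m + 36 * k))).card + 4 * S := by
    intro m hm
    rw [Finset.mem_range] at hm
    obtain ⟨hx1, hx2, -, hx4⟩ := hx m
    rw [hS]
    refine shiftPairs_block_count (x m) K (2 ^ n) hx4 ?_
    obtain ⟨t, ht⟩ : ∃ t, x m + 36 * K = 2 ^ (n - 1) + m * 2 ^ (j + 1) + t :=
      ⟨x m + 36 * K - (2 ^ (n - 1) + m * 2 ^ (j + 1)), by omega⟩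
    have htA : t < 2 ^ (j + 1) := by omega
    have := (shiftPairs_block n j m t hj2 (by omega) htA).1
    omega
  -- injection `(m, k) ↦ x m + 36 k` of the good pairs into the target set
  refine le_trans ?_ (Nat.mul_le_mul_left 512 (Finset.card_le_card_of_injOn
    (s := (Finset.range M).sigma
      (fun m => (Finset.range K).filter (fun k => Squarefree (x m + 36 * k))))
    (fun mk => x mk.1 + 36 * mk.2) ?maps ?inj))
  case maps =>
    rintro ⟨m, k⟩ hmk
    simp only [Finset.coe_sigma, Set.mem_sigma_iff, Finset.mem_coe, Finset.mem_range,
      Finset.mem_filter] at hmk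
    obtain ⟨hm, hk, hsq⟩ := hmk
    obtain ⟨hx1, hx2, hx3, -⟩ := hx m
    exact Finset.mem_coe.2 (shiftPairs_ap_mem n j a₀ m (x m) k hj2 (by omega) ha4 ha9 hx1 hx2
      hx3 (by omega) hsq)
  case inj =>
    rintro ⟨m₁, k₁⟩ h₁ ⟨m₂, k₂⟩ h₂ heq
    simp only [Finset.coe_sigma, Set.mem_sigma_iff, Finset.mem_coe, Finset.mem_range,
      Finset.mem_filter] at h₁ h₂
    have heq' : x m₁ + 36 * k₁ = x m₂ + 36 * k₂ := heq
    obtain ⟨hx1, hx2, -, -⟩ := hx m₁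
    obtain ⟨hy1, hy2, -, -⟩ := hx m₂
    have e₁ := shiftPairs_ap_div n j m₁ (x m₁) k₁ hj2 (by omega) hx1 hx2 (by omega)
    have e₂ := shiftPairs_ap_div n j m₂ (x m₂) k₂ hj2 (by omega) hy1 hy2 (by omega)
    rw [heq'] at e₁
    have hm : m₁ = m₂ := by omega
    subst hm
    have hk : k₁ = k₂ := by omega
    subst hk
    rfl
  -- summation over the blocks and the final arithmetic
  rw [Finset.card_sigma]
  have hsum := Finset.card_nsmul_le_sum (Finset.range M)
    (fun m => 4 * ((Finset.range K).filter (fun k => Squarefree (x m + 36 * k))).card + 4 * S)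
    (3 * K) hblock
  rw [Finset.card_range, smul_eq_mul, Finset.sum_add_distrib, ← Finset.mul_sum, Finset.sum_const,
    Finset.card_range, smul_eq_mul] at hsum
  have h6 := Nat.mul_le_mul_left M h96
  linarith

end Summit.QuantumAdvantage.QuantumAdvantage.Theorems.IqThreeNotPPoly
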